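import Mathlib.Algebra.BigOperators.Fin
import Mathlib.Algebra.Order.BigOperators.Ring.Finset
import Mathlib.Analysis.Complex.Exponential
import Mathlib.Analysis.SpecialFunctions.Log.Basic
import Mathlib.Data.Fin.Tuple.Basic
import Mathlib.Data.Fintype.BigOperators
import Literature.Computability.QuantumComplexity.SampleQueryAccess
import HarnessLib

/-!
# Randomized Kaczmarz: exponential convergence in expectation (Strohmer–Vershynin 2009, Thm 2)

T. Strohmer, R. Vershynin, *A randomized Kaczmarz algorithm with exponential convergence*,
J. Fourier Anal. Appl. 15 (2009) 262–278 = arXiv:math/0702226 [StrohmerVershynin2009], **§2,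
Algorithm 1 and Theorem 2** (the theorem is numbered "Theorem 3" in the held arXiv
materialisation `paper:arxiv-math_0702226`, p0004; journal numbering is used below):

> **Algorithm 1 (Random Kaczmarz algorithm).** Let `Ax = b` be a linear system of equations as
> in (1) [consistent, `A` of full column rank] and let `x₀` be arbitrary initial approximation to
> the solution of (1). For `k = 0, 1, …` compute
> `x_{k+1} = x_k + (b_{r(i)} − ⟨a_{r(i)}, x_k⟩)/‖a_{r(i)}‖₂² · a_{r(i)}`, where `r(i)` is chosen
> from the set `{1, 2, …, m}` at random, with probability proportional to `‖a_{r(i)}‖₂²`.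
>
> **Theorem 2.** Let `x` be the solution of (1). Then Algorithm 1 converges to `x` in
> expectation, with the average error `E‖x_k − x‖₂² ≤ (1 − κ(A)⁻²)^k · ‖x₀ − x‖₂²`.

Here `κ(A) := ‖A‖_F ‖A⁻¹‖₂` is the scaled condition number and "`‖A⁻¹‖₂` is the smallest constant
`M` such that the inequality `‖Ax‖₂ ≥ ‖x‖₂/M` holds for all vectors `x`" (p0003), so that
`κ(A)⁻² = σ²/‖A‖_F²` with `σ² = ‖A⁻¹‖₂⁻² = σ_min(A)²`; and **§2.1** ("Quadratic time"): accuracy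
`E‖x_k − x‖₂² ≤ ε²‖x₀ − x‖₂²` is reached after `E k_ε ≤ 2 log ε / log(1 − κ(A)⁻²) ≈ 2κ(A)² log(1/ε)`
iterations.

The same statement is **Definition 1 / Lemma 2** of C. Shao, A. Montanaro, *Faster
quantum-inspired algorithms for solving linear systems*, ACM Trans. Quantum Comput. 3(4) (2022) =
arXiv:2103.10309 [ShaoMontanaro2022], p. 6 of the held text: "**Lemma 2** (Theorem 2 of
[Strohmer–Vershynin]). Let `x*` be the solution of (LSP). Then the randomized Kaczmarz algorithm
converges to `x*` in expectation, with the average error `E[‖x_T − x*‖²] ≤ (1 − κ_F⁻²)^T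
‖x₀ − x*‖²`, where `κ_F = ‖A‖_F‖A⁻¹‖`. […] by Markov's inequality, with high probability 0.99, we
have `‖x_T − x*‖² ≤ 100(1 − κ_F⁻²)^T‖x*‖²`. To make sure the error is bounded by `ε²‖x*‖²` with
high probability, it suffices to choose `T = O(κ_F² log(1/ε))`. From (Definition 1), we know that
there exist `y_{k,0}, …, y_{k,k−1}` such that `x_k = ∑_j y_{k,j} A_{r(j)*}`, that is `x_k = A†y_k`
for some vector `y_k`. One obvious fact is that `y_k` is at most `k`-sparse." — the engine of
their quantum-inspired linear-system solvers (Theorems 11, 12, 14 there, which are NOT formalized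
here).  The dictionary to the sampling-and-query access model of `SampleQueryAccess.lean`
(Chia–Gilyén–Li–Lin–Tang–Wang 2022, Def. 2.9 [ChiaEtAl2022]) is literal: the Kaczmarz row law
"probability proportional to `‖a_r‖₂²`" IS `SampleQuery.rowDist A r = ‖A(r,·)‖²/‖A‖_F²`, the
sampling half of `SQ(A)`, and one step reads one row of `A` and one entry of `b` (query access).

## What is formalized (real case, finite path space; no named facts — everything is proved)

* `step A b i x` — the update of Algorithm 1 / Definition 1; `dotProduct_step` (it lands on the
  hyperplane `⟨a_i, ·⟩ = b_i`); `normSq_step_sub` — Pythagoras for the projection,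
  `‖x' − x*‖² = ‖x − x*‖² − ⟨a_i, x − x*⟩²/‖a_i‖²` (p0004, the display before "To complete the
  proof").
* `sum_rowDist_mul_normSq_step_sub` — the one-step expectation EXACTLY:
  `∑ᵢ rowDist A i ‖x'_i − x*‖² = ‖z‖² − ‖Az‖²/‖A‖_F²`, `z = x − x*` (eqs. (6)–(7) of the proof with
  equality), and `sum_rowDist_mul_normSq_step_sub_le`: `≤ (1 − σ²/‖A‖_F²)‖z‖²` whenever
  `σ²‖z‖² ≤ ‖Az‖²` for all `z`.
* `expErr A b x* k x₀ = E‖x_k − x*‖²` (rows i.i.d. `∼ rowDist A`; defined by conditioning on the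
  first step) and `expErr_eq_sum` — its closed form as the finite sum over row sequences
  `ω : Fin k → Fin m` of `(∏ⱼ rowDist A (ω j)) · ‖iter ω x₀ − x*‖²`.
* **Theorem 2**: `expErr_le` — `E‖x_k − x*‖² ≤ (1 − σ²/‖A‖_F²)^k ‖x₀ − x*‖²`.
* §2.1 / the remark after SM22 Lemma 2: `expErr_le_of_iterations` — `≤ ε‖x₀ − x*‖²` once
  `k ≥ (‖A‖_F²/σ²) log(1/ε) = κ_F² log(1/ε)` (via `1 − q ≤ e^{−q}`; SV09's exact
  `2 log ε / log(1 − κ⁻²)` is not reproduced), and the Markov remark `weight_far_le`.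
* SM22's sparse description: `iter_eq_add_sum_smul` — `x_k = x₀ + ∑_{j<k} yⱼ a_{ω j}` with the
  explicit coefficients `coeffs` (SM22 take `x₀ = 0`, so `x_k = A†y_k` with `y_k` `k`-sparse).

Design choices. Real matrices `Matrix (Fin m) (Fin n) ℝ` and vectors `Fin n → ℝ` (both sources
allow `ℂ`; the dequantized applications use the real case — `-- TODO(general form): RCLike`).
SV09's standing hypotheses "consistent, full column rank" enter as `hxs : A *ᵥ x* = b` and the
quantitative `hσ : ∀ z, σ²‖z‖² ≤ ‖Az‖²` (`σ² = ‖A⁻¹‖₂⁻²` is theirs; any `σ²` is allowed, `σ² ≤ 0`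
giving a trivial rate), so the rate `1 − σ²/‖A‖_F²` is literally `1 − κ(A)⁻²`. Zero rows are
harmless: `rowDist` gives them probability `0` and `step` is the identity on them (division junk
value `·/0 = 0`). Expectations over the i.i.d. row choices are finite sums — no measure theory.
Running times, the `SQ(x_k)` output routines and SM22 Theorems 11–14 are NOT modelled.

## References
* [StrohmerVershynin2009] T. Strohmer, R. Vershynin, J. Fourier Anal. Appl. 15:262–278 (2009),
  doi:10.1007/s00041-008-9030-4, arXiv:math/0702226 — §2 Algorithm 1, Theorem 2, §2.1.
* [ShaoMontanaro2022] C. Shao, A. Montanaro, ACM Trans. Quantum Comput. 3(4) (2022),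
  doi:10.1145/3520141, arXiv:2103.10309 — Definition 1, Lemma 2 and the remarks following it.
* [ChiaEtAl2022] N.-H. Chia, A. Gilyén, T. Li, H.-H. Lin, E. Tang, C. Wang, J. ACM 69(5):33
  (2022), doi:10.1145/3549524, Def. 2.9 (`SQ(A)`: the row law `rowDist`).
-/

noncomputable section

open Finset Matrix

namespace Literature.Analysis.Matrix

namespace Kaczmarz

open _root_.Literature.Computability.QuantumComplexity.SampleQuery

variable {m n : ℕ}

/-! ### Definitions: the step, the iterate along a row sequence, `E‖x_k − x*‖²` -/

/-- The Kaczmarz update for row `i`: `x + (b_i − ⟨a_i, x⟩)/‖a_i‖² · a_i`, the orthogonal projection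
of `x` onto the hyperplane `⟨a_i, ·⟩ = b_i` (the identity on a zero row: junk value `·/0 = 0`).
[cite: StrohmerVershynin2009, §2 Algorithm 1]; [cite: ShaoMontanaro2022, Definition 1] -/
def step (A : Matrix (Fin m) (Fin n) ℝ) (b : Fin m → ℝ) (i : Fin m) (x : Fin n → ℝ) :
    Fin n → ℝ :=
  x + ((b i - A i ⬝ᵥ x) / normSq (A i)) • A i

/-- The iterate `x_k` along the row sequence `ω : Fin k → Fin m` (row `ω 0` is used first).
[cite: StrohmerVershynin2009, §2 Algorithm 1] -/
def iter (A : Matrix (Fin m) (Fin n) ℝ) (b : Fin m → ℝ) :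
    (k : ℕ) → (Fin k → Fin m) → (Fin n → ℝ) → (Fin n → ℝ)
  | 0, _, x => x
  | k + 1, ω, x => iter A b k (Fin.tail ω) (step A b (ω 0) x)

/-- The coefficients of the sparse description `x_k = x₀ + ∑_{j<k} yⱼ · a_{ω j}` along `ω`.
[cite: ShaoMontanaro2022, remark after Lemma 2 ("`x_k = A†y_k` … `y_k` is at most `k`-sparse")] -/
def coeffs (A : Matrix (Fin m) (Fin n) ℝ) (b : Fin m → ℝ) :
    (k : ℕ) → (Fin k → Fin m) → (Fin n → ℝ) → (Fin k → ℝ)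
  | 0, _, _ => fun j => j.elim0
  | k + 1, ω, x =>
    Fin.cons ((b (ω 0) - A (ω 0) ⬝ᵥ x) / normSq (A (ω 0)))
      (coeffs A b k (Fin.tail ω) (step A b (ω 0) x))

/-- `E‖x_k − x*‖²` for the iteration started at `x`, the rows drawn independently from
`rowDist A`, defined by conditioning on the first step: `E₀(x) = ‖x − x*‖²`,
`E_{k+1}(x) = ∑ᵢ rowDist A i · E_k(step i x)`; its closed form as a sum over row sequences is
`expErr_eq_sum`. [cite: StrohmerVershynin2009, §2 Theorem 2] -/
def expErr (A : Matrix (Fin m) (Fin n) ℝ) (b : Fin m → ℝ) (xs : Fin n → ℝ) :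
    ℕ → (Fin n → ℝ) → ℝ
  | 0, x => normSq (x - xs)
  | k + 1, x => ∑ i, rowDist A i * expErr A b xs k (step A b i x)

/-! ### Vector bookkeeping (private plumbing) -/

/-- `‖v‖² = ⟨v, v⟩`. [folklore] -/
private theorem normSq_eq_dotProduct (v : Fin n → ℝ) : normSq v = v ⬝ᵥ v := by
  simp [normSq, dotProduct, sq]

/-- `‖0‖² = 0`. [folklore] -/
@[simp] private theorem normSq_zero : normSq (0 : Fin n → ℝ) = 0 := by
  simp [normSq]

/-- `‖z − t·a‖² = ‖z‖² − 2t⟨a, z⟩ + t²‖a‖²`. [folklore] -/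
private theorem normSq_sub_smul (z a : Fin n → ℝ) (t : ℝ) :
    normSq (z - t • a) = normSq z - 2 * t * (a ⬝ᵥ z) + t ^ 2 * normSq a := by
  have h : ∀ i, (z i - t * a i) ^ 2 = z i ^ 2 - 2 * t * (a i * z i) + t ^ 2 * a i ^ 2 :=
    fun i => by ring
  simp only [normSq, dotProduct, Pi.sub_apply, Pi.smul_apply, smul_eq_mul, h, sum_add_distrib,
    sum_sub_distrib, ← mul_sum]

/-- `‖Az‖² = ∑ᵢ ⟨a_i, z⟩²` (the left side of eq. (6) of the proof). [folklore] -/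
private theorem normSq_mulVec (A : Matrix (Fin m) (Fin n) ℝ) (z : Fin n → ℝ) :
    normSq (A *ᵥ z) = ∑ i, (A i ⬝ᵥ z) ^ 2 := rfl

/-- Cauchy–Schwarz: `⟨a, z⟩² ≤ ‖a‖² ‖z‖²`. [folklore] -/
private theorem dotProduct_sq_le (a z : Fin n → ℝ) : (a ⬝ᵥ z) ^ 2 ≤ normSq a * normSq z :=
  sum_mul_sq_le_sq_mul_sq univ a z

/-- `‖Az‖² ≤ ‖A‖_F² ‖z‖²`. [folklore] -/
private theorem normSq_mulVec_le (A : Matrix (Fin m) (Fin n) ℝ) (z : Fin n → ℝ) :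
    normSq (A *ᵥ z) ≤ frobSq A * normSq z := by
  rw [normSq_mulVec, frobSq, sum_mul]
  exact sum_le_sum fun i _ => dotProduct_sq_le (A i) z

/-- The row law is nonnegative: `rowDist A i ≥ 0`. [cite: ChiaEtAl2022, Def. 2.9] -/
theorem rowDist_nonneg (A : Matrix (Fin m) (Fin n) ℝ) (i : Fin m) : 0 ≤ rowDist A i :=
  div_nonneg (normSq_nonneg _) (sum_nonneg fun j _ => normSq_nonneg (A j))

/-- The row law is a probability distribution for `A ≠ 0`: `∑ᵢ ‖a_i‖²/‖A‖_F² = 1`.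
[cite: StrohmerVershynin2009, §2 Algorithm 1 ("probability proportional to `‖a_{r(i)}‖₂²`")] -/
theorem sum_rowDist {A : Matrix (Fin m) (Fin n) ℝ} (hF : frobSq A ≠ 0) : ∑ i, rowDist A i = 1 := by
  simp only [rowDist, ← sum_div]
  exact div_self hF

/-- The weight `∏ⱼ rowDist A (ω j)` of a row sequence is nonnegative. [folklore] -/
private theorem pathWeight_nonneg (A : Matrix (Fin m) (Fin n) ℝ) {k : ℕ} (ω : Fin k → Fin m) :
    0 ≤ ∏ j, rowDist A (ω j) :=
  prod_nonneg fun j _ => rowDist_nonneg A (ω j)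

/-! ### One step (Algorithm 1 / Definition 1) and its error (proof of Theorem 2, p0004) -/

section OneStep

variable {A : Matrix (Fin m) (Fin n) ℝ} {b : Fin m → ℝ} {xs : Fin n → ℝ}

/-- The step lands on the chosen hyperplane: `⟨a_i, x'⟩ = b_i` for a nonzero row. [cite:
ShaoMontanaro2022, remark after Definition 1 ("the orthogonal projection … onto the hyperplane")] -/
theorem dotProduct_step (b : Fin m → ℝ) {i : Fin m} (hi : A i ≠ 0) (x : Fin n → ℝ) :
    A i ⬝ᵥ step A b i x = b i := by
  have h0 : normSq (A i) ≠ 0 := (normSq_pos hi).ne'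
  rw [step, dotProduct_add, dotProduct_smul, smul_eq_mul, ← normSq_eq_dotProduct,
    div_mul_cancel₀ _ h0]
  ring

/-- With `A x* = b`: `x' − x* = z − (⟨a_i, z⟩/‖a_i‖²)·a_i`, `z = x − x*` ("`Pz = z − ⟨z − x, Z⟩Z`").
[cite: StrohmerVershynin2009, §2 proof of Theorem 2] -/
theorem step_sub_eq (hxs : A *ᵥ xs = b) (i : Fin m) (x : Fin n → ℝ) :
    step A b i x - xs = (x - xs) - ((A i ⬝ᵥ (x - xs)) / normSq (A i)) • A i := by
  have hb : A i ⬝ᵥ xs = b i := congrFun hxs i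
  rw [step, ← hb, dotProduct_sub, show (A i ⬝ᵥ xs - A i ⬝ᵥ x) / normSq (A i)
      = -((A i ⬝ᵥ x - A i ⬝ᵥ xs) / normSq (A i)) by ring, neg_smul]
  abel

/-- Pythagoras for the projection: `‖x' − x*‖² = ‖x − x*‖² − ⟨a_i, x − x*⟩²/‖a_i‖²` (also on a
zero row, where both sides are `‖x − x*‖²`). [cite: StrohmerVershynin2009, §2 proof of Theorem 2] -/
theorem normSq_step_sub (hxs : A *ᵥ xs = b) (i : Fin m) (x : Fin n → ℝ) :
    normSq (step A b i x - xs) = normSq (x - xs) - (A i ⬝ᵥ (x - xs)) ^ 2 / normSq (A i) := by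
  rw [step_sub_eq hxs, normSq_sub_smul]
  rcases eq_or_ne (normSq (A i)) 0 with h0 | h0
  · simp [h0]
  · field_simp
    ring

/-- Averaging one row's contribution: `rowDist A i · ‖x'_i − x*‖² = rowDist A i · ‖z‖² −
⟨a_i, z⟩²/‖A‖_F²`. [cite: StrohmerVershynin2009, §2 proof of Theorem 2, eq. (7)] -/
theorem rowDist_mul_normSq_step_sub (hxs : A *ᵥ xs = b) (i : Fin m) (x : Fin n → ℝ) :
    rowDist A i * normSq (step A b i x - xs)
      = rowDist A i * normSq (x - xs) - (A i ⬝ᵥ (x - xs)) ^ 2 / frobSq A := by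
  rw [normSq_step_sub hxs, mul_sub]
  congr 1
  rcases eq_or_ne (normSq (A i)) 0 with h0 | h0
  · have hAi : A i = 0 := (normSq_eq_zero_iff _).1 h0
    simp [rowDist, hAi]
  · rw [rowDist, div_mul_div_comm, mul_comm (normSq (A i)), mul_div_mul_right _ _ h0]

/-- The one-step expectation over the row law, EXACTLY:
`∑ᵢ rowDist A i · ‖x'_i − x*‖² = ‖z‖² − ‖Az‖²/‖A‖_F²`, `z = x − x*` (eqs. (6)–(7) of the proof,
with equality in place of `≥ κ(A)⁻²‖z‖²`).
[cite: StrohmerVershynin2009, §2 proof of Theorem 2, eqs. (6)–(7)] -/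
theorem sum_rowDist_mul_normSq_step_sub (hxs : A *ᵥ xs = b) (hF : frobSq A ≠ 0)
    (x : Fin n → ℝ) :
    ∑ i, rowDist A i * normSq (step A b i x - xs)
      = normSq (x - xs) - normSq (A *ᵥ (x - xs)) / frobSq A := by
  simp only [rowDist_mul_normSq_step_sub hxs]
  rw [sum_sub_distrib, ← sum_mul, sum_rowDist hF, one_mul, ← sum_div, normSq_mulVec]

/-- Hence `E_i‖x' − x*‖² ≤ (1 − σ²/‖A‖_F²)·‖x − x*‖²` whenever `σ²‖z‖² ≤ ‖Az‖²` for all `z`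
(with `σ² = ‖A⁻¹‖₂⁻²` the factor is `1 − κ(A)⁻²`: "the error reduces at each step in average by at
least the factor `1 − κ(A)⁻²`"). [cite: StrohmerVershynin2009, §2 proof of Theorem 2] -/
theorem sum_rowDist_mul_normSq_step_sub_le (hxs : A *ᵥ xs = b) (hF : 0 < frobSq A) {σ2 : ℝ}
    (hσ : ∀ z, σ2 * normSq z ≤ normSq (A *ᵥ z)) (x : Fin n → ℝ) :
    ∑ i, rowDist A i * normSq (step A b i x - xs) ≤ (1 - σ2 / frobSq A) * normSq (x - xs) := by
  rw [sum_rowDist_mul_normSq_step_sub hxs hF.ne', one_sub_mul, div_mul_eq_mul_div]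
  exact sub_le_sub_left (div_le_div_of_nonneg_right (hσ _) hF.le) _

/-- `σ² ≤ ‖A‖_F²` (test `hσ` on a nonzero row and use Cauchy–Schwarz), i.e. `κ(A) ≥ 1`.
[cite: StrohmerVershynin2009, §1 eq. (3)] -/
theorem sigma_le_frobSq (hF : 0 < frobSq A) {σ2 : ℝ}
    (hσ : ∀ z, σ2 * normSq z ≤ normSq (A *ᵥ z)) : σ2 ≤ frobSq A := by
  obtain ⟨i, -, hi⟩ : ∃ i ∈ (univ : Finset (Fin m)), normSq (A i) ≠ 0 := by
    by_contra h
    exact hF.ne' (sum_eq_zero fun i hi => not_not.1 fun hne => h ⟨i, hi, hne⟩)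
  have hpos : 0 < normSq (A i) := lt_of_le_of_ne (normSq_nonneg _) (Ne.symm hi)
  exact le_of_mul_le_mul_right ((hσ (A i)).trans (normSq_mulVec_le A (A i))) hpos

/-- The contraction factor is nonnegative: `0 ≤ 1 − σ²/‖A‖_F²`.
[cite: StrohmerVershynin2009, §1 eq. (3)] -/
theorem contraction_nonneg (hF : 0 < frobSq A) {σ2 : ℝ}
    (hσ : ∀ z, σ2 * normSq z ≤ normSq (A *ᵥ z)) : 0 ≤ 1 - σ2 / frobSq A :=
  sub_nonneg.2 ((div_le_one hF).2 (sigma_le_frobSq hF hσ))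

/-! ### Theorem 2 and the iteration count -/

/-- **Theorem 2** (Strohmer–Vershynin 2009) = SM22 Lemma 2:
`E‖x_k − x*‖² ≤ (1 − κ(A)⁻²)^k · ‖x₀ − x*‖²`, where `κ(A)⁻² = σ²/‖A‖_F²` for any `σ²` with
`σ²‖z‖² ≤ ‖Az‖²` for all `z` (theirs is `σ² = ‖A⁻¹‖₂⁻² = σ_min(A)²`).
[cite: StrohmerVershynin2009, §2 Theorem 2]; [cite: ShaoMontanaro2022, Lemma 2] -/
theorem expErr_le (hxs : A *ᵥ xs = b) (hF : 0 < frobSq A) {σ2 : ℝ}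
    (hσ : ∀ z, σ2 * normSq z ≤ normSq (A *ᵥ z)) (k : ℕ) (x : Fin n → ℝ) :
    expErr A b xs k x ≤ (1 - σ2 / frobSq A) ^ k * normSq (x - xs) := by
  induction k generalizing x with
  | zero => simp [expErr]
  | succ k ih =>
    have hq := contraction_nonneg hF hσ
    calc expErr A b xs (k + 1) x
        = ∑ i, rowDist A i * expErr A b xs k (step A b i x) := by simp only [expErr]
      _ ≤ ∑ i, rowDist A i * ((1 - σ2 / frobSq A) ^ k * normSq (step A b i x - xs)) :=
          sum_le_sum fun i _ => mul_le_mul_of_nonneg_left (ih _) (rowDist_nonneg A i)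
      _ = (1 - σ2 / frobSq A) ^ k * ∑ i, rowDist A i * normSq (step A b i x - xs) := by
          rw [mul_sum]
          exact sum_congr rfl fun i _ => by ring
      _ ≤ (1 - σ2 / frobSq A) ^ k * ((1 - σ2 / frobSq A) * normSq (x - xs)) :=
          mul_le_mul_of_nonneg_left (sum_rowDist_mul_normSq_step_sub_le hxs hF hσ x)
            (pow_nonneg hq k)
      _ = (1 - σ2 / frobSq A) ^ (k + 1) * normSq (x - xs) := by ring

/-- `(1 − q)^k ≤ ε` as soon as `q·k ≥ log(1/ε)` (`q ≤ 1`), via `1 − q ≤ e^{−q}`. [folklore] -/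
private theorem one_sub_pow_le_of_log_le {q ε : ℝ} (hq1 : q ≤ 1) (hε : 0 < ε) {k : ℕ}
    (hk : Real.log (1 / ε) ≤ q * k) : (1 - q) ^ k ≤ ε := by
  rw [one_div, Real.log_inv] at hk
  calc (1 - q) ^ k ≤ Real.exp (-q) ^ k :=
        pow_le_pow_left₀ (sub_nonneg.2 hq1) (Real.one_sub_le_exp_neg q) k
    _ = Real.exp (-(q * k)) := by rw [← Real.exp_nat_mul, mul_neg, mul_comm]
    _ ≤ Real.exp (Real.log ε) := Real.exp_le_exp.2 (by linarith)
    _ = ε := Real.exp_log hε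

/-- §2.1 of SV09 / the remark after SM22 Lemma 2 ("it suffices to choose `T = O(κ_F² log(1/ε))`"):
after `k ≥ κ_F² · log(1/ε)` iterations, `κ_F² = ‖A‖_F²/σ²`, the expected squared error is at most
`ε · ‖x₀ − x*‖²`. [cite: StrohmerVershynin2009, §2.1]; [cite: ShaoMontanaro2022, Lemma 2 ff.] -/
theorem expErr_le_of_iterations (hxs : A *ᵥ xs = b) (hF : 0 < frobSq A) {σ2 : ℝ}
    (hσ0 : 0 < σ2) (hσ : ∀ z, σ2 * normSq z ≤ normSq (A *ᵥ z)) {ε : ℝ} (hε : 0 < ε) {k : ℕ}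
    (hk : frobSq A / σ2 * Real.log (1 / ε) ≤ k) (x : Fin n → ℝ) :
    expErr A b xs k x ≤ ε * normSq (x - xs) := by
  refine (expErr_le hxs hF hσ k x).trans (mul_le_mul_of_nonneg_right ?_ (normSq_nonneg _))
  refine one_sub_pow_le_of_log_le ((div_le_one hF).2 (sigma_le_frobSq hF hσ)) hε ?_
  have h1 : σ2 / frobSq A * (frobSq A / σ2) = 1 := by
    rw [div_mul_div_comm, mul_comm (frobSq A) σ2]
    exact div_self (mul_ne_zero hσ0.ne' hF.ne')
  have h2 := mul_le_mul_of_nonneg_left hk (div_pos hσ0 hF).le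
  rw [← mul_assoc, h1, one_mul] at h2
  exact h2

/-! ### The path space: explicit expectation, Markov, sparse description -/

/-- `E‖x_k − x*‖²` written out over row sequences: `∑_{ω ∈ [m]^k} P(ω) · ‖x_k(ω) − x*‖²` with
`P(ω) = ∏ⱼ rowDist A (ω j)` (independent draws from the row law).
[cite: StrohmerVershynin2009, §2 proof of Theorem 2 ("Taking the full expectation")] -/
theorem expErr_eq_sum (k : ℕ) (x : Fin n → ℝ) :
    expErr A b xs k x
      = ∑ ω : Fin k → Fin m, (∏ j, rowDist A (ω j)) * normSq (iter A b k ω x - xs) := by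
  induction k generalizing x with
  | zero => simp [expErr, iter]
  | succ k ih =>
    simp only [expErr]
    rw [← (Fin.consEquiv fun _ => Fin m).sum_comp, Fintype.sum_prod_type]
    refine sum_congr rfl fun i _ => ?_
    rw [ih, mul_sum]
    refine sum_congr rfl fun ω _ => ?_
    simp only [Fin.consEquiv, Equiv.coe_fn_mk, iter, Fin.prod_univ_succ, Fin.cons_zero,
      Fin.cons_succ, Fin.tail_cons]
    ring

/-- Markov ("with high probability 0.99, `‖x_T − x*‖² ≤ 100(1 − κ_F⁻²)^T‖x₀ − x*‖²`"): the row
sequences on which `‖x_k − x*‖² ≥ t` have total probability at most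
`(1 − σ²/‖A‖_F²)^k · ‖x₀ − x*‖²/t`. [cite: ShaoMontanaro2022, remark after Lemma 2] -/
theorem weight_far_le (hxs : A *ᵥ xs = b) (hF : 0 < frobSq A) {σ2 : ℝ}
    (hσ : ∀ z, σ2 * normSq z ≤ normSq (A *ᵥ z)) (k : ℕ) (x : Fin n → ℝ) {t : ℝ} (ht : 0 < t) :
    ∑ ω ∈ univ.filter (fun ω : Fin k → Fin m => t ≤ normSq (iter A b k ω x - xs)),
        ∏ j, rowDist A (ω j) ≤ (1 - σ2 / frobSq A) ^ k * normSq (x - xs) / t := by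
  rw [le_div_iff₀ ht, sum_mul]
  calc ∑ ω ∈ univ.filter (fun ω : Fin k → Fin m => t ≤ normSq (iter A b k ω x - xs)),
          (∏ j, rowDist A (ω j)) * t
      ≤ ∑ ω ∈ univ.filter (fun ω : Fin k → Fin m => t ≤ normSq (iter A b k ω x - xs)),
          (∏ j, rowDist A (ω j)) * normSq (iter A b k ω x - xs) :=
        sum_le_sum fun ω hω =>
          mul_le_mul_of_nonneg_left (mem_filter.1 hω).2 (pathWeight_nonneg A ω)
    _ ≤ ∑ ω, (∏ j, rowDist A (ω j)) * normSq (iter A b k ω x - xs) :=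
        sum_le_sum_of_subset_of_nonneg (filter_subset _ _) fun ω _ _ =>
          mul_nonneg (pathWeight_nonneg A ω) (normSq_nonneg _)
    _ = expErr A b xs k x := (expErr_eq_sum k x).symm
    _ ≤ (1 - σ2 / frobSq A) ^ k * normSq (x - xs) := expErr_le hxs hF hσ k x

/-- The sparse description: `x_k = x₀ + ∑_{j<k} yⱼ · a_{ω j}` with `y = coeffs A b k ω x₀` — the
iterate differs from `x₀` by a combination of the (at most `k`) rows used.
[cite: ShaoMontanaro2022, remark after Lemma 2] -/
theorem iter_eq_add_sum_smul (k : ℕ) (ω : Fin k → Fin m) (x : Fin n → ℝ) :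
    iter A b k ω x = x + ∑ j, coeffs A b k ω x j • A (ω j) := by
  induction k generalizing x with
  | zero => simp [iter]
  | succ k ih =>
    rw [iter, ih, Fin.sum_univ_succ]
    simp only [coeffs, Fin.cons_zero, Fin.cons_succ, Fin.tail]
    rw [step]
    abel

end OneStep

end Kaczmarz

end Literature.Analysis.Matrix

end
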